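import Summits.BirchSwinnertonDyer.BirchSwinnertonDyer.Theorems.CyclotomicUntwistNineDescendedFrobeniusOfOmegaColumn
import Summits.BirchSwinnertonDyer.BirchSwinnertonDyer.Theorems.CyclotomicUntwistNineLogUnbounded
import HarnessLib

/-!
# Route `CyclotomicUntwist`: the named fact `isDescendedFrobeniusMatrix_exists` from the ONE power map `z ↦ z³`
# (KATZ3: `ClassesIndependent ∧ IsPowerMapMatrix 3 M` on the good models, `M ∈ M₂(ℚ₃)`) — `M₁₀ ≠ 0` DERIVED

Cell `pub/bsd-wall` (D-0145 line `route-BirchSwinnertonDyer-CyclotomicUntwist`), prover seat `bsd-line-cycu-p3`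
(gen 8), lane «KATZ FROBENIUS MOD ϖ» (p632401 Key Lemma mod `ϖ`, p633281 Frobenius relation on all second-kind classes).
THEOREMS ONLY (no definition, no named fact, no `sorry`); helper `--supports` K1 = stmt-BirchSwinnertonDyer-21580 (K2 =
21581; print child C2 = 27549 / 27616). BSD is not proved by this file and no crux is. DEDUP: the `ω`-column algebra
(power maps compose, `M = !![c, ((a−c)c−3)/d; d, a−c]`, det/trace, the named fact from the `ω`-column datum) is the
lead's `CyclotomicUntwistNineDescendedFrobeniusOfOmegaColumn` (p633233, cycu-p1 g6) and is IMPORTED, not re-proved.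

## What is proved

`isDescendedFrobeniusMatrix_exists_of_powerMapThree`: the Literature named fact
`WeierstrassCurve.isDescendedFrobeniusMatrix_exists` (`DescendedFrobeniusMatrix`, p623342: `det M = 3`, `tr M = a`, and
for every good model `ClassesIndependent`, `IsPowerMapMatrix 9 (M²)`, `IsPowerMapMatrix 27 (M³)`) follows from

  KATZ3: for every `W/ℚ`, good model `𝓜` over `𝓞_{ℚ₃(ζ₉)}` and `ρ` with `3 ∣ 𝓜.specialFibreTrace ρ`, some
  `M ∈ M₂(ℚ₃)` has, for EVERY good model `𝓜'`, `𝓜'.ClassesIndependent ∧ 𝓜'.IsPowerMapMatrix 3 M`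

— i.e. the SAME two Literature predicates, with the single power map `z ↦ z³` (well defined on Katz's module by p632401)
in place of `z⁹, z²⁷`, and NO clause on `det`, `tr` or `M₁₀`. The point proved here is that `M₁₀ ≠ 0` is automatic
(`M₁₀ = 0` would make `φ[ω] ≡ M₀₀[ω]` with `M₀₀ ∈ ℚ₃`, excluded by the lead's
`NineLogUnbounded.not_hbd_expand_sub_algebraMap_mul_classOmega`: Honda/Frobenius relation + Eisenstein), and that
`ClassesIndependent` + the `ω`-column give the independence of `([ω], φ[ω])`; the rest is
`NineDescendedFrobeniusOfOmegaColumn.isDescendedFrobeniusMatrix_exists_of_omegaColumnTransfer`.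
[cite: Katz1981CrystallineDieudonne, §5 Thm 5.1.4, Thm 5.7.2 and (6.1.1)] [cite: BerthelotOgus1983, Prop. (3.14)]
-/

set_option autoImplicit false
-- single-conjunct summit: `Summit.BirchSwinnertonDyer.BirchSwinnertonDyer.…` repeats the name by design
set_option linter.dupNamespace false

noncomputable section

open PowerSeries Literature.NumberTheory.EllipticCurves Literature.NumberTheory.EllipticCurves.DescendedFrobenius
  Summit.BirchSwinnertonDyer.BirchSwinnertonDyer.Theorems.DescendedFrobeniusTransfer
  Summit.BirchSwinnertonDyer.BirchSwinnertonDyer.Theorems.NineDescendedFrobeniusOfOmegaColumn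
  Summit.BirchSwinnertonDyer.BirchSwinnertonDyer.Theorems.NineLogUnbounded

namespace Summit.BirchSwinnertonDyer.BirchSwinnertonDyer.Theorems.KatzFrobenius

variable {W : WeierstrassCurve ℚ}

/-- The `ω`-column of `IsPowerMapMatrix 3 (M ⊗ ℚ₃(ζ₉))`, in the `C`-multiplication form of the lead's files:
`ω(z³) − M₀₀·ω − M₁₀·η` has bounded denominators. [cite: Katz1981CrystallineDieudonne, §5 Thm 5.1.4] -/
theorem hbd_omegaColumn_of_isPowerMapMatrix (𝓜 : W.NineGoodModel) {M : Matrix (Fin 2) (Fin 2) ℚ_[3]}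
    (h : 𝓜.IsPowerMapMatrix 3 (by norm_num) (M.map (algebraMap ℚ_[3] KNine))) :
    HasBoundedDenominators (expand 3 (by norm_num) 𝓜.classOmega -
      PowerSeries.C (algebraMap ℚ_[3] KNine (M 0 0)) * 𝓜.classOmega -
      PowerSeries.C (algebraMap ℚ_[3] KNine (M 1 0)) * 𝓜.classEta) := by
  have h1 := h.1
  rwa [Matrix.map_apply, Matrix.map_apply, smul_eq_C_mul, smul_eq_C_mul] at h1

/-- **`ClassesIndependent` + the `ω`-column ⟹ `([ω], φ[ω])` independent** modulo bounded denominators: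
`x[ω] + y·φ[ω] ≡ (x + yc)[ω] + yd[η]`, so `yd = 0` and (as `d ≠ 0`) `y = 0`, `x = 0`.
[cite: Katz1981CrystallineDieudonne, Thm. 5.3.3] -/
theorem omegaPhiOmega_independent (𝓜 : W.NineGoodModel) {c d : KNine} (hd : d ≠ 0) (hI : 𝓜.ClassesIndependent)
    (hω : HasBoundedDenominators (expand 3 (by norm_num) 𝓜.classOmega - PowerSeries.C c * 𝓜.classOmega -
      PowerSeries.C d * 𝓜.classEta))
    (x y : KNine) (hxy : HasBoundedDenominators (PowerSeries.C x * 𝓜.classOmega +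
      PowerSeries.C y * expand 3 (by norm_num) 𝓜.classOmega)) :
    x = 0 ∧ y = 0 := by
  have hcomb := hxy.sub (hbd_C_mul y hω)
  have e : PowerSeries.C x * 𝓜.classOmega + PowerSeries.C y * expand 3 (by norm_num) 𝓜.classOmega -
        PowerSeries.C y * (expand 3 (by norm_num) 𝓜.classOmega - PowerSeries.C c * 𝓜.classOmega -
          PowerSeries.C d * 𝓜.classEta) =
      (x + y * c) • 𝓜.classOmega + (y * d) • 𝓜.classEta := by
    rw [smul_eq_C_mul, smul_eq_C_mul, map_add, map_mul, map_mul]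
    ring
  rw [e] at hcomb
  obtain ⟨h1, h2⟩ := hI _ _ hcomb
  have hy : y = 0 := by
    rcases mul_eq_zero.mp h2 with h | h
    · exact h
    · exact absurd h hd
  rw [hy, zero_mul, add_zero] at h1
  exact ⟨h1, hy⟩

/-- **THE REDUCTION: `isDescendedFrobeniusMatrix_exists` ⟸ KATZ3.** If, for every `W/ℚ` with a good model `𝓜` over
`𝓞_{ℚ₃(ζ₉)}` whose special fibre along `ρ` is supersingular, some `M ∈ M₂(ℚ₃)` makes, for EVERY good model, the
classes `[ω_W], [η_W]` independent and the pull-back `z ↦ z³` act by `M` (`IsPowerMapMatrix 3 M`), then the Literature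
named fact holds. `M₁₀ ≠ 0` is derived (lead's `not_hbd_expand_sub_algebraMap_mul_classOmega`), the `ω`-column data
`(c, d) = (M₀₀, M₁₀)` and `ClassesIndependent` feed the lead's `isDescendedFrobeniusMatrix_exists_of_omegaColumnTransfer`.
[cite: Katz1981CrystallineDieudonne, §5 Thm 5.1.4, Thm 5.7.2 and (6.1.1)] [cite: BerthelotOgus1983, Prop. (3.14)] -/
theorem isDescendedFrobeniusMatrix_exists_of_powerMapThree
    (hK : ∀ (W : WeierstrassCurve ℚ) (𝓜 : W.NineGoodModel) (ρ : ONine →+* ZMod 3),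
      (3 : ℤ) ∣ 𝓜.specialFibreTrace ρ →
        ∃ M : Matrix (Fin 2) (Fin 2) ℚ_[3], ∀ 𝓜' : W.NineGoodModel,
          𝓜'.ClassesIndependent ∧ 𝓜'.IsPowerMapMatrix 3 (by norm_num) (M.map (algebraMap ℚ_[3] KNine))) :
    WeierstrassCurve.isDescendedFrobeniusMatrix_exists := by
  refine isDescendedFrobeniusMatrix_exists_of_omegaColumnTransfer fun W 𝓜 ρ h3t ↦ ?_
  obtain ⟨M, hM⟩ := hK W 𝓜 ρ h3t
  have hω : ∀ 𝓜' : W.NineGoodModel, HasBoundedDenominators (expand 3 (by norm_num) 𝓜'.classOmega -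
      PowerSeries.C (algebraMap ℚ_[3] KNine (M 0 0)) * 𝓜'.classOmega -
      PowerSeries.C (algebraMap ℚ_[3] KNine (M 1 0)) * 𝓜'.classEta) :=
    fun 𝓜' ↦ hbd_omegaColumn_of_isPowerMapMatrix 𝓜' (hM 𝓜').2
  -- `M₁₀ ≠ 0`: otherwise `φ[ω] ≡ M₀₀[ω]` with `M₀₀ ∈ ℚ₃` on the supersingular model `𝓜`
  have hd : M 1 0 ≠ 0 := by
    intro h0
    have h := hω 𝓜
    rw [h0, map_zero, map_zero, zero_mul, sub_zero] at h
    exact not_hbd_expand_sub_algebraMap_mul_classOmega 𝓜 ρ h3t (M 0 0) h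
  have hd' : algebraMap ℚ_[3] KNine (M 1 0) ≠ 0 := (map_ne_zero _).mpr hd
  exact ⟨M 0 0, M 1 0, hd, hω, fun 𝓜' ↦ omegaPhiOmega_independent 𝓜' hd' (hM 𝓜').1 (hω 𝓜')⟩

end Summit.BirchSwinnertonDyer.BirchSwinnertonDyer.Theorems.KatzFrobenius
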